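import Mathlib
import Summits.KontsevichZagierPeriods.Zeta5Search.SecondOrderDigit
import HarnessLib

/-!
# G10ModP — `r(b) mod p` is a partial-fraction coefficient sum of `R_b mod p` (REPORT-gen2-g10 §6.9, "THEOREM R̄")

HONEST FRAMING: systematic search; no irrationality claim unless certified.

INCREMENT over the tree's `Zeta5Search/SecondOrderDigit.lean` (p231819) and the staged `G10ThirdOrder.lean`; nothing is redeclared.

Reduce `R_b` modulo `p`: `R̄_b = 2·∏_{x ∈ F_p} (t + x)^{E_x}` with `E_x = classExp b p x` (the odd centre sits at the residue `b₀/2` and is already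
counted in `classExp`).  At a residue `x` of pole order `n_x = −E_x` the leading partial-fraction coefficient of `R̄_b` is
`ḡ_x = 2∏_{y ≠ x}(y − x)^{E_y}` (`= ĝ_q mod p` for every class point `q`, cf. `ClusterValuation.gHat`) and the next one is `ḡ_x·φ̄_x` with
`φ̄_x = Σ_{y ≠ x} E_y/(y − x)` (`= phiHat mod p`).  THEOREM R̄ (REPORT §6.9(b), PROVED on paper from the second-digit lemma and the pair identities of
THEOREM A‴; exact check `g10/rbar_live.py`: 0 counterexamples among 222 + (seed 12) random instances and 48 X-ray instances): under the hypotheses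
(T1) "one palindromic deep type `T`" and (T2) "the `E = −M+1` layer consists of raises of `T` / the odd-centre class" (the first four class binders
of `LawA4`), the second-order aggregate satisfies `r(b) ≡ −(u/2)·S̄(b)·τ(T) (mod p)` with `u` a fixed `p`-adic unit and
`S̄(b) := Σ_{x deep} ḡ_xφ̄_x + Σ_{x live, ν_x = −M+1} ḡ_x ∈ ZMod p` (`sBar` below; tame single classes are invisible).  Consequently, if `S̄(b) = 0`
and `S̄(b + e_j) = 0` then `r(b) ≡ r(b+e_j) ≡ 0`, `det(r(b), r(b+e_j)) ≡ 0 (mod p²)` and `v_p(Cas_j) ≥ casLB + 4` — this is `LawR4`, the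
fourth-digit law that covers the "polluted" θ sub-ranges of the X cells (X1 `θ < 25/2`, X2 `θ < 21/2`, X3 `θ ≤ 23/2`), where the double-raise
hypothesis (T3) of `LawA4` fails but `S̄(b) = S̄(b+e₇) = 0` holds at all 12 computed instances (REPORT §6.9(a)); above the thresholds `LawA4` applies.
STRUCTURE (REPORT §6.9(c),(d)): `R̄_b = (t^p − t)^{−N}·ρ` with `ρ` the remainder-arc configuration; a complete-sum lemma and the reflection symmetry
leave `S̄ = ±Σ_{μ−1}(ρ)` (`μ = M − N`) as the only surviving coefficient sum; on the polluted ranges `μ = 4` and `Σ_3(ρ) = 0` is OBSERVED (the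
"moment triangle" law, open).  `sBar` is computable, so both `S̄`-hypotheses of `LawR4` are decidable per instance.
-/

open Finset

namespace Summit.KontsevichZagierPeriods.Zeta5Search.SecondOrder

open Summit.KontsevichZagierPeriods.Zeta5Search.ClusterValuation
open Summit.KontsevichZagierPeriods.Zeta5Search.CasoratianValuation (InPolytope shift casoratian)

/-! ## §1 The reduced invariants `ḡ_x, φ̄_x, S̄` in `ZMod p` -/

/-- `ḡ_x := 2·∏_{y ≠ x, y < p} (y − x)^{E_y} ∈ ZMod p` (negative powers through `ZMod.inv`; `E_y = classExp`, centre included). -/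
def gBar (b : ℕ → ℤ) (p x : ℕ) : ZMod p :=
  2 * (∏ y ∈ (range p).erase (x % p), ((y : ZMod p) - (x : ZMod p)) ^ (max (classExp b p y) 0).toNat)
    * (∏ y ∈ (range p).erase (x % p), ((y : ZMod p) - (x : ZMod p)) ^ (max (-classExp b p y) 0).toNat)⁻¹

/-- `φ̄_x := Σ_{y ≠ x, y < p} E_y·(y − x)⁻¹ ∈ ZMod p`. -/
def phiBar (b : ℕ → ℤ) (p x : ℕ) : ZMod p :=
  ∑ y ∈ (range p).erase (x % p), ((classExp b p y : ℤ) : ZMod p) * (((y : ZMod p) - (x : ZMod p)))⁻¹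

/-- `S̄(b) := Σ_{x multipole, E_x = −M} ḡ_xφ̄_x + Σ_{x pole class, ν_x = −M+1} ḡ_x` — the live part of the `(M−1)`-th partial-fraction coefficient sum of
`R_b mod p` (tame single classes have `ν_x ≥ 0` and drop out). -/
def sBar (b : ℕ → ℤ) (p M : ℕ) : ZMod p :=
  (∑ x ∈ multipoleClasses b p, if classExp b p x = -(M : ℤ) then gBar b p x * phiBar b p x else 0)
    + ∑ x ∈ (range p).filter (fun x => 1 ≤ classPoleCount b p x ∧ classNu b p x = -(M : ℤ) + 1), gBar b p x

/-! ## §2 LawR4 — the fourth digit from `S̄(b) = S̄(b + e_j) = 0` -/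

/-- **LawR4** (REPORT-gen2-g10 §6.9; PROVED on paper given THEOREM R̄, itself proved on paper from the digit lemmas): in the window `5 ≤ p ≤ b₀ < p² − 2`,
if `b` and `b + e_j` both satisfy (H0) every multipole class has exponent `≥ −M` and every single-pole class `ν ≥ −M+1` (`M ≥ 6` even), (T1) one
palindromic deep type `T` (resp. `T'`), not containing the centre, (T2) every pole class with `ν = −M+1` is a raise of the deep type or the odd-centre
class of that type, and if `S̄(b) = 0` and `S̄(b+e_j) = 0` in `ZMod p`, then `v_p(Cas_j(b)) ≥ 7 − 2M = casLB + 4`. -/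
@[conjecture] def LawR4 : Prop :=
  ∀ (b : ℕ → ℤ) (p j M : ℕ) (T T' : List ℤ), InPolytope b → InPolytope (shift b j) → 1 ≤ j → j ≤ 7 → p.Prime → 5 ≤ p → (p : ℤ) ≤ b 0 →
    (b 0 + 2 : ℤ) < (p : ℤ) ^ 2 → 6 ≤ M → Even M → T.reverse = T → T'.reverse = T' →
    (∀ x ∈ multipoleClasses b p, -(M : ℤ) ≤ classExp b p x) →
    (∀ y, y < p → classPoleCount b p y = 1 → -(M : ℤ) + 1 ≤ classNu b p y) →
    (∀ x ∈ multipoleClasses b p, classExp b p x = -(M : ℤ) → ¬ CentreIn b p x ∧ classTypeList b p x = T) →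
    (∀ y, y < p → 1 ≤ classPoleCount b p y → classNu b p y = -(M : ℤ) + 1 →
        isRaise T (classTypeList b p y) = true ∨ (¬ (2 : ℤ) ∣ b 0 ∧ CentreIn b p y ∧ classTypeList b p y = T)) →
    (∀ x ∈ multipoleClasses (shift b j) p, -(M : ℤ) ≤ classExp (shift b j) p x) →
    (∀ y, y < p → classPoleCount (shift b j) p y = 1 → -(M : ℤ) + 1 ≤ classNu (shift b j) p y) →
    (∀ x ∈ multipoleClasses (shift b j) p, classExp (shift b j) p x = -(M : ℤ) → ¬ CentreIn (shift b j) p x ∧ classTypeList (shift b j) p x = T') →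
    (∀ y, y < p → 1 ≤ classPoleCount (shift b j) p y → classNu (shift b j) p y = -(M : ℤ) + 1 →
        isRaise T' (classTypeList (shift b j) p y) = true ∨ (¬ (2 : ℤ) ∣ b 0 ∧ CentreIn (shift b j) p y ∧ classTypeList (shift b j) p y = T')) →
    sBar b p M = 0 → sBar (shift b j) p M = 0 →
    casoratian b j ≠ 0 → (7 : ℤ) - 2 * M ≤ padicValRat p (casoratian b j)

end Summit.KontsevichZagierPeriods.Zeta5Search.SecondOrder
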